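import Summits.SmoothPoincare4.SmoothPoincare4.Theorems.CylinderEntropySliceIsolationStubSeparationPersistsAux7
import Summits.SmoothPoincare4.SmoothPoincare4.Theorems.CylinderEntropySliceIsolationStubSeparationPersistsAux4
import HarnessLib

/-!
# End-separation persists along a cylinder flow, part 8: end-separation — the open half (core)

Part of the proof of the stub `stub_separationPersists` (END-SEPARATION PERSISTS ALONG A CYLINDER
FLOW) of line `conformal-kernel-domination` (closing chain γ) of the crux `CylinderEntropy.SliceIsolation`
(stmt-SmoothPoincare4-7632); see `CylinderEntropySliceIsolationStubSeparationPersists.lean` for the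
overall argument. Everything here is proved (no named facts).

`cylFlow_not_joinedIn_near` — **the two sides persist for nearby slices**: two points joined off
`F t (M)` to the two reference push-offs `nrm(F(t,x₀) ∓ τ₀ w₀)`, `w₀ = ± ν(t, x₀)`, are NOT joined
off `F s (M)` for `s` near `t`: the joining paths are compact and stay off the uniformly close slice;
the reference push-offs are joined by short normalised segments to the push-offs
`nrm(F(s,x₀) ± τ₀ ŵ)` of the new slice (`ŵ = ± ν(s, x₀)` sign-fixed, close to `w₀` by part 4), which
lie on different sides of `F s (M)` (part 3, Jordan–Brouwer).

## References

* M. W. Hirsch, *Differential Topology*, GTM 33 (1976), Ch. 4 §5 (tubular neighbourhoods), Ch. 8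
  Thm. 1.3 (isotopy extension). [HirschDT1976]
* A. Hatcher, *Algebraic Topology*, CUP (2002), Prop. 3.46 (Jordan–Brouwer separation via Alexander
  duality). [HatcherAT2002]
-/

set_option linter.dupNamespace false

noncomputable section

open MeasureTheory Set Function Filter Module Asymptotics Metric
open scoped Manifold ContDiff ENNReal Topology RealInnerProductSpace NNReal

namespace Summit.SmoothPoincare4.SmoothPoincare4.Theorems.CylinderEntropySliceIsolation

open Summit.SmoothPoincare4.SmoothPoincare4.Theorems.CylinderRungTwo.KillingFlux
open Literature.Geometry.Riemannian
open Literature.Geometry.Lorentzian Literature.Geometry.Lorentzian.PseudoRiemannianMetric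
open Literature.Geometry.Riemannian.SphericalCylinderEntropy (truncL truncL_apply lipschitz_truncL)
open Literature.Geometry.Manifold.CylinderSlice (axis castSucc_ne_five padL padL_apply_castSucc
  padL_apply_last)

section OpenHalf

open Summit.SmoothPoincare4.SmoothPoincare4.Cruxes.CylinderRungTwo.KillingFlux (IsCylinderMCF SeparatesEnds cylN)

variable {M : Type} [TopologicalSpace M] [ChartedSpace (EuclideanSpace ℝ (Fin 4)) M]
  [IsManifold (𝓡 4) ∞ M]

variable {F : ℝ → M → EuclideanSpace ℝ (Fin 6)} {ν : ℝ → M → EuclideanSpace ℝ (Fin 6)} {T : ℝ}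

/-- The radial normalisation is continuous at every point off the axis. [folklore] -/
theorem continuousAt_nrm {u : EuclideanSpace ℝ (Fin 6)} (hu : truncL u ≠ 0) :
    ContinuousAt (fun z : EuclideanSpace ℝ (Fin 6) => (‖truncL z‖⁻¹ : ℝ) • (z - z (5 : Fin 6) •
      (axis : EuclideanSpace ℝ (Fin 6))) + z (5 : Fin 6) • (axis : EuclideanSpace ℝ (Fin 6))) u :=
  continuousOn_nrm.continuousAt ((isOpen_ne_fun truncL.continuous continuous_const).mem_nhds hu)

/-- **The two sides persist for nearby slices (the open half, core).** Fix `t ≥ T`, a point `x₀`,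
a uniform push-off radius `τ₀` valid for all times `θ₁`-close to `t` (`cylFlow_exists_uniform_pushoff`),
a unit normal direction `w₀ = ± ν(t, x₀)`, and two points `a, b ∈ N` joined in `N ∖ F t (M)` to
the push-offs `Q_a = nrm(F(t,x₀) - τ₀ w₀)`, `Q_b = nrm(F(t,x₀) + τ₀ w₀)` respectively.  Then for
all times `s ≥ T` close to `t`, `a` and `b` are NOT joined in `N ∖ F s (M)`: the two joining paths
are compact and stay off the uniformly close slice `F s (M)`; `Q_b` is joined by a short normalised
segment to the push-off `nrm(F(s,x₀) + τ₀ ŵ)` of the slice `F s` (`ŵ = ± ν(s, x₀)` the sign with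
`⟪ŵ, w₀⟫ ≥ 0`, close to `w₀` since normals converge up to sign), and `Q_a` to `nrm(F(s,x₀) - τ₀ ŵ)`;
but these two push-offs of `F s (M)` are not joined in its complement (Jordan–Brouwer,
`not_joinedIn_pushoff`). [folklore] -/
theorem cylFlow_not_joinedIn_near [T2Space M] [CompactSpace M] [ConnectedSpace M] (h : IsCylinderMCF M F ν T)
    {t : ℝ} (ht : T ≤ t) (x₀ : M) {τ₀ θ₁ : ℝ} (hτ₀ : 0 < τ₀) (hθ₁ : 0 < θ₁)
    (hpo : ∀ s : ℝ, T ≤ s → |s - t| < θ₁ → ∀ x : M, ∀ τ ∈ Ioc (0 : ℝ) τ₀,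
      (fun z : EuclideanSpace ℝ (Fin 6) => (‖truncL z‖⁻¹ : ℝ) • (z - z (5 : Fin 6) •
        (axis : EuclideanSpace ℝ (Fin 6))) + z (5 : Fin 6) • (axis : EuclideanSpace ℝ (Fin 6))) (F s x + τ • ν s x) ∉
          range (F s) ∧
      (fun z : EuclideanSpace ℝ (Fin 6) => (‖truncL z‖⁻¹ : ℝ) • (z - z (5 : Fin 6) •
        (axis : EuclideanSpace ℝ (Fin 6))) + z (5 : Fin 6) • (axis : EuclideanSpace ℝ (Fin 6))) (F s x + τ • (-ν s x)) ∉
          range (F s))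
    {w₀ : EuclideanSpace ℝ (Fin 6)} (hw₀ : w₀ = ν t x₀ ∨ w₀ = -ν t x₀)
    {a b : EuclideanSpace ℝ (Fin 6)}
    (haQ : JoinedIn (({z : EuclideanSpace ℝ (Fin 6) | ∑ i : Fin 5, z (Fin.castSucc i) ^ 2 = 1} :
        Set (EuclideanSpace ℝ (Fin 6))) \ range (F t)) a
      ((fun z : EuclideanSpace ℝ (Fin 6) => (‖truncL z‖⁻¹ : ℝ) • (z - z (5 : Fin 6) •
        (axis : EuclideanSpace ℝ (Fin 6))) + z (5 : Fin 6) • (axis : EuclideanSpace ℝ (Fin 6))) (F t x₀ + τ₀ • (-w₀))))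
    (hbQ : JoinedIn (({z : EuclideanSpace ℝ (Fin 6) | ∑ i : Fin 5, z (Fin.castSucc i) ^ 2 = 1} :
        Set (EuclideanSpace ℝ (Fin 6))) \ range (F t)) b
      ((fun z : EuclideanSpace ℝ (Fin 6) => (‖truncL z‖⁻¹ : ℝ) • (z - z (5 : Fin 6) •
        (axis : EuclideanSpace ℝ (Fin 6))) + z (5 : Fin 6) • (axis : EuclideanSpace ℝ (Fin 6))) (F t x₀ + τ₀ • w₀))) :
    ∃ θ : ℝ, 0 < θ ∧ ∀ s : ℝ, T ≤ s → |s - t| < θ →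
      ¬ JoinedIn (({z : EuclideanSpace ℝ (Fin 6) | ∑ i : Fin 5, z (Fin.castSucc i) ^ 2 = 1} :
        Set (EuclideanSpace ℝ (Fin 6))) \ range (F s)) a b := by
  set Ncyl : Set (EuclideanSpace ℝ (Fin 6)) := {z : EuclideanSpace ℝ (Fin 6) | ∑ i : Fin 5, z (Fin.castSucc i) ^ 2 = 1}
    with hNcyl
  -- name the two reference push-offs
  obtain ⟨Qa, hQa⟩ : ∃ Q : EuclideanSpace ℝ (Fin 6), Q = (fun z : EuclideanSpace ℝ (Fin 6) => (‖truncL z‖⁻¹ : ℝ) •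
      (z - z (5 : Fin 6) • (axis : EuclideanSpace ℝ (Fin 6))) + z (5 : Fin 6) • (axis : EuclideanSpace ℝ (Fin 6)))
      (F t x₀ + τ₀ • (-w₀)) := ⟨_, rfl⟩
  obtain ⟨Qb, hQb⟩ : ∃ Q : EuclideanSpace ℝ (Fin 6), Q = (fun z : EuclideanSpace ℝ (Fin 6) => (‖truncL z‖⁻¹ : ℝ) •
      (z - z (5 : Fin 6) • (axis : EuclideanSpace ℝ (Fin 6))) + z (5 : Fin 6) • (axis : EuclideanSpace ℝ (Fin 6)))
      (F t x₀ + τ₀ • w₀) := ⟨_, rfl⟩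
  rw [← hQa] at haQ
  rw [← hQb] at hbQ
  have hιN := h.mem_cyl t ht
  have hνn := h.isUnitNormal t ht
  -- the direction `w₀` is a unit vector tangent to `N` at `F t x₀`
  have hw₀t : ∑ i : Fin 5, w₀ (Fin.castSucc i) * F t x₀ (Fin.castSucc i) = 0 := by
    rcases hw₀ with hw | hw
    · rw [hw]; exact h.normal_tangent t ht x₀
    · rw [hw]; simp only [PiLp.neg_apply, neg_mul, Finset.sum_neg_distrib, h.normal_tangent t ht x₀, neg_zero]
  have hw₀t' : ∑ i : Fin 5, (-w₀) (Fin.castSucc i) * F t x₀ (Fin.castSucc i) = 0 := by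
    simp only [PiLp.neg_apply, neg_mul, Finset.sum_neg_distrib, hw₀t, neg_zero]
  have hw₀1 : ‖w₀‖ = 1 := by
    rcases hw₀ with hw | hw
    · rw [hw]; exact norm_nu hνn x₀
    · rw [hw, norm_neg]; exact norm_nu hνn x₀
  have hQaN : Qa ∈ Ncyl := by rw [hQa]; exact sum_sq_nrm (norm_nrm_sub_le (hιN x₀) hw₀t' τ₀).1
  have hQbN : Qb ∈ Ncyl := by rw [hQb]; exact sum_sq_nrm (norm_nrm_sub_le (hιN x₀) hw₀t τ₀).1
  -- `Qa, Qb ∉ F t (M)` (push-offs of radius `τ₀` at time `t`)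
  have hpot := hpo t ht (by simp [hθ₁]) x₀ τ₀ ⟨hτ₀, le_rfl⟩
  have hQnot : Qa ∉ range (F t) ∧ Qb ∉ range (F t) := by
    rcases hw₀ with hw | hw
    · refine ⟨?_, ?_⟩
      · rw [hQa, hw]; exact hpot.2
      · rw [hQb, hw]; exact hpot.1
    · refine ⟨?_, ?_⟩
      · rw [hQa, hw, neg_neg]; exact hpot.1
      · rw [hQb, hw]; exact hpot.2
  have hSc : IsClosed (range (F t)) := (isCompact_range (h.isSmoothEmbedding t ht).contMDiff.continuous).isClosed
  haveI : Nonempty M := ⟨x₀⟩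
  have hηa : 0 < infDist Qa (range (F t)) := (hSc.notMem_iff_infDist_pos (range_nonempty _)).1 hQnot.1
  have hηb : 0 < infDist Qb (range (F t)) := (hSc.notMem_iff_infDist_pos (range_nonempty _)).1 hQnot.2
  set ηa := infDist Qa (range (F t)) with hηa_def
  set ηb := infDist Qb (range (F t)) with hηb_def
  -- the two paths and their positive distances from the slice
  obtain ⟨γa, hγa⟩ := haQ
  obtain ⟨γb, hγb⟩ := hbQ
  obtain ⟨da, hda, hdale⟩ := (isCompact_range γa.continuous).exists_forall_le'
    (continuous_infDist_pt (range (F t))).continuousOn (a := 0)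
    (by rintro _ ⟨τ, rfl⟩; exact (hSc.notMem_iff_infDist_pos (range_nonempty _)).1 (hγa τ).2)
  obtain ⟨db, hdb, hdble⟩ := (isCompact_range γb.continuous).exists_forall_le'
    (continuous_infDist_pt (range (F t))).continuousOn (a := 0)
    (by rintro _ ⟨τ, rfl⟩; exact (hSc.notMem_iff_infDist_pos (range_nonempty _)).1 (hγb τ).2)
  -- continuity of the normalisation at the two pushed-off points
  have hcont : ∀ {u : EuclideanSpace ℝ (Fin 6)}, truncL u ≠ 0 → ∀ ε : ℝ, 0 < ε → ∃ κ : ℝ, 0 < κ ∧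
      ∀ u' : EuclideanSpace ℝ (Fin 6), dist u' u < κ →
        dist ((fun z : EuclideanSpace ℝ (Fin 6) => (‖truncL z‖⁻¹ : ℝ) • (z - z (5 : Fin 6) •
          (axis : EuclideanSpace ℝ (Fin 6))) + z (5 : Fin 6) • (axis : EuclideanSpace ℝ (Fin 6))) u')
          ((fun z : EuclideanSpace ℝ (Fin 6) => (‖truncL z‖⁻¹ : ℝ) • (z - z (5 : Fin 6) •
          (axis : EuclideanSpace ℝ (Fin 6))) + z (5 : Fin 6) • (axis : EuclideanSpace ℝ (Fin 6))) u) < ε := by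
    intro u hu ε hε
    have hca := continuousOn_nrm.continuousAt ((isOpen_ne_fun truncL.continuous continuous_const).mem_nhds hu)
    obtain ⟨κ, hκ, hκ'⟩ := Metric.continuousAt_iff.1 hca ε hε
    exact ⟨κ, hκ, fun u' hu' => hκ' hu'⟩
  obtain ⟨κa, hκa, hκa'⟩ := hcont (norm_nrm_sub_le (hιN x₀) hw₀t' τ₀).1 (min (ηa / 4) (1 / 4)) (by positivity)
  obtain ⟨κb, hκb, hκb'⟩ := hcont (norm_nrm_sub_le (hιN x₀) hw₀t τ₀).1 (min (ηb / 4) (1 / 4)) (by positivity)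
  -- tolerances
  set c : ℝ := min κa κb / (2 * τ₀) with hc
  have hc0 : 0 < c := by positivity
  obtain ⟨θ₃, hθ₃, hnu⟩ := cylFlow_exists_abs_inner_nu_gt h ht x₀ (ε := c ^ 2 / 2) (by positivity)
  set ε₂ : ℝ := min (min (min da db) (min ηa ηb) / 2) (min κa κb / 2) with hε₂
  have hε₂0 : 0 < ε₂ := by positivity
  obtain ⟨θ₂, hθ₂, hclose⟩ := cylFlow_uniform_close h ht hε₂0
  refine ⟨min (min θ₁ θ₂) θ₃, by positivity, fun s hsT hst hJ => ?_⟩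
  have hs1 : |s - t| < θ₁ := lt_of_lt_of_le hst ((min_le_left _ _).trans (min_le_left _ _))
  have hs2 : |s - t| < θ₂ := lt_of_lt_of_le hst ((min_le_left _ _).trans (min_le_right _ _))
  have hs3 : |s - t| < θ₃ := lt_of_lt_of_le hst (min_le_right _ _)
  have hε₂da : ε₂ < da := by
    have : ε₂ ≤ min (min da db) (min ηa ηb) / 2 := min_le_left _ _
    have : min (min da db) (min ηa ηb) ≤ da := (min_le_left _ _).trans (min_le_left _ _)
    linarith
  have hε₂db : ε₂ < db := by
    have : ε₂ ≤ min (min da db) (min ηa ηb) / 2 := min_le_left _ _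
    have : min (min da db) (min ηa ηb) ≤ db := (min_le_left _ _).trans (min_le_right _ _)
    linarith
  have hε₂ηa : ε₂ ≤ ηa / 2 := by
    have : ε₂ ≤ min (min da db) (min ηa ηb) / 2 := min_le_left _ _
    have : min (min da db) (min ηa ηb) ≤ ηa := (min_le_right _ _).trans (min_le_left _ _)
    linarith
  have hε₂ηb : ε₂ ≤ ηb / 2 := by
    have : ε₂ ≤ min (min da db) (min ηa ηb) / 2 := min_le_left _ _
    have : min (min da db) (min ηa ηb) ≤ ηb := (min_le_right _ _).trans (min_le_right _ _)
    linarith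
  have hε₂κ : ε₂ ≤ min κa κb / 2 := min_le_right _ _
  have hclose' := hclose s hsT hs2
  have hιsN := h.mem_cyl s hsT
  have hνsn := h.isUnitNormal s hsT
  -- the sign-fixed normal `ŵ = ± ν(s, x₀)` with `⟪ŵ, w₀⟫ ≥ 0`
  obtain ⟨ŵ, hŵ, hŵw⟩ : ∃ ŵ : EuclideanSpace ℝ (Fin 6), (ŵ = ν s x₀ ∨ ŵ = -ν s x₀) ∧ ‖ŵ - w₀‖ < c := by
    have habs : |⟪ν s x₀, w₀⟫| = |⟪ν s x₀, ν t x₀⟫| := by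
      rcases hw₀ with hw | hw
      · rw [hw]
      · rw [hw, inner_neg_right, abs_neg]
    have hgt := hnu s hsT hs3
    rw [← habs] at hgt
    by_cases hsign : 0 ≤ ⟪ν s x₀, w₀⟫
    · refine ⟨ν s x₀, Or.inl rfl, norm_sub_lt_of_inner_gt (norm_nu hνsn x₀) hw₀1 hc0 ?_⟩
      rwa [abs_of_nonneg hsign] at hgt
    · refine ⟨-ν s x₀, Or.inr rfl, norm_sub_lt_of_inner_gt (by rw [norm_neg]; exact norm_nu hνsn x₀) hw₀1 hc0 ?_⟩
      rw [inner_neg_left]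
      rwa [abs_of_neg (not_le.1 hsign)] at hgt
  have hŵt : ∑ i : Fin 5, ŵ (Fin.castSucc i) * F s x₀ (Fin.castSucc i) = 0 := by
    rcases hŵ with hw | hw
    · rw [hw]; exact h.normal_tangent s hsT x₀
    · rw [hw]; simp only [PiLp.neg_apply, neg_mul, Finset.sum_neg_distrib, h.normal_tangent s hsT x₀, neg_zero]
  have hŵt' : ∑ i : Fin 5, (-ŵ) (Fin.castSucc i) * F s x₀ (Fin.castSucc i) = 0 := by
    simp only [PiLp.neg_apply, neg_mul, Finset.sum_neg_distrib, hŵt, neg_zero]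
  -- the push-offs of the slice `F s` at `x₀`
  obtain ⟨Qas, hQas⟩ : ∃ Q : EuclideanSpace ℝ (Fin 6), Q = (fun z : EuclideanSpace ℝ (Fin 6) => (‖truncL z‖⁻¹ : ℝ) •
      (z - z (5 : Fin 6) • (axis : EuclideanSpace ℝ (Fin 6))) + z (5 : Fin 6) • (axis : EuclideanSpace ℝ (Fin 6)))
      (F s x₀ + τ₀ • (-ŵ)) := ⟨_, rfl⟩
  obtain ⟨Qbs, hQbs⟩ : ∃ Q : EuclideanSpace ℝ (Fin 6), Q = (fun z : EuclideanSpace ℝ (Fin 6) => (‖truncL z‖⁻¹ : ℝ) •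
      (z - z (5 : Fin 6) • (axis : EuclideanSpace ℝ (Fin 6))) + z (5 : Fin 6) • (axis : EuclideanSpace ℝ (Fin 6)))
      (F s x₀ + τ₀ • ŵ) := ⟨_, rfl⟩
  have hQasN : Qas ∈ Ncyl := by rw [hQas]; exact sum_sq_nrm (norm_nrm_sub_le (hιsN x₀) hŵt' τ₀).1
  have hQbsN : Qbs ∈ Ncyl := by rw [hQbs]; exact sum_sq_nrm (norm_nrm_sub_le (hιsN x₀) hŵt τ₀).1
  -- (3) the new push-offs are close to the old ones
  have hmove : ∀ v : EuclideanSpace ℝ (Fin 6), ‖v - w₀‖ < c →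
      dist (F s x₀ + τ₀ • v) (F t x₀ + τ₀ • w₀) < min κa κb := by
    intro v hv
    rw [dist_eq_norm]
    have h1 : ‖F s x₀ - F t x₀‖ < min κa κb / 2 := lt_of_lt_of_le (hclose' x₀) hε₂κ
    have h2 : τ₀ * ‖v - w₀‖ < min κa κb / 2 := by
      have := mul_lt_mul_of_pos_left hv hτ₀
      rw [hc] at this
      have heq : τ₀ * (min κa κb / (2 * τ₀)) = min κa κb / 2 := by field_simp
      linarith
    calc ‖F s x₀ + τ₀ • v - (F t x₀ + τ₀ • w₀)‖ = ‖(F s x₀ - F t x₀) + τ₀ • (v - w₀)‖ := by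
          congr 1; rw [smul_sub]; abel
      _ ≤ ‖F s x₀ - F t x₀‖ + ‖τ₀ • (v - w₀)‖ := norm_add_le _ _
      _ = ‖F s x₀ - F t x₀‖ + τ₀ * ‖v - w₀‖ := by rw [norm_smul, Real.norm_of_nonneg hτ₀.le]
      _ < min κa κb / 2 + min κa κb / 2 := add_lt_add h1 h2
      _ = min κa κb := by ring
  have hQb_close : dist Qbs Qb < min (ηb / 4) (1 / 4) := by
    rw [hQbs, hQb]
    exact hκb' _ (lt_of_lt_of_le (hmove ŵ hŵw) (min_le_right _ _))
  have hQa_close : dist Qas Qa < min (ηa / 4) (1 / 4) := by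
    rw [hQas, hQa]
    refine hκa' _ (lt_of_lt_of_le ?_ (min_le_left κa κb))
    rw [dist_eq_norm]
    have h1 : ‖F s x₀ - F t x₀‖ < min κa κb / 2 := lt_of_lt_of_le (hclose' x₀) hε₂κ
    have h2 : τ₀ * ‖ŵ - w₀‖ < min κa κb / 2 := by
      have := mul_lt_mul_of_pos_left hŵw hτ₀
      have heq : τ₀ * (min κa κb / (2 * τ₀)) = min κa κb / 2 := by field_simp
      linarith
    calc ‖F s x₀ + τ₀ • (-ŵ) - (F t x₀ + τ₀ • (-w₀))‖ = ‖(F s x₀ - F t x₀) - τ₀ • (ŵ - w₀)‖ := by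
          congr 1; rw [smul_sub, smul_neg, smul_neg]; abel
      _ ≤ ‖F s x₀ - F t x₀‖ + ‖τ₀ • (ŵ - w₀)‖ := norm_sub_le _ _
      _ = ‖F s x₀ - F t x₀‖ + τ₀ * ‖ŵ - w₀‖ := by rw [norm_smul, Real.norm_of_nonneg hτ₀.le]
      _ < min κa κb / 2 + min κa κb / 2 := add_lt_add h1 h2
      _ = min κa κb := by ring
  -- (1) the slice `F s` stays away from `Qa, Qb`
  have hfarQ : ∀ {Q : EuclideanSpace ℝ (Fin 6)} {η : ℝ}, η = infDist Q (range (F t)) → ε₂ ≤ η / 2 →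
      ∀ y ∈ range (F s), η / 2 < ‖y - Q‖ := by
    rintro Q η rfl hε _ ⟨x, rfl⟩
    have h1 : infDist Q (range (F t)) ≤ dist Q (F t x) := infDist_le_dist_of_mem ⟨x, rfl⟩
    rw [dist_comm, dist_eq_norm] at h1
    have h2 : ‖F s x - F t x‖ < ε₂ := hclose' x
    have h3 : ‖F t x - Q‖ ≤ ‖F s x - Q‖ + ‖F s x - F t x‖ := by
      calc ‖F t x - Q‖ = ‖(F s x - Q) - (F s x - F t x)‖ := by congr 1; abel
        _ ≤ ‖F s x - Q‖ + ‖F s x - F t x‖ := norm_sub_le _ _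
    linarith
  -- short segments from `Qb` to `Qbs` and from `Qa` to `Qas` inside `N ∖ F s (M)`
  have hsegQ : ∀ {Q Q' : EuclideanSpace ℝ (Fin 6)} {η : ℝ}, Q ∈ Ncyl → Q' ∈ Ncyl → η = infDist Q (range (F t)) →
      ε₂ ≤ η / 2 → dist Q' Q < min (η / 4) (1 / 4) → JoinedIn (Ncyl \ range (F s)) Q Q' := by
    intro Q Q' η hQ hQ' hη hε hd
    rw [dist_eq_norm] at hd
    have hd1 : ‖Q' - Q‖ < 1 / 2 := by linarith [min_le_right (η / 4) (1 / 4)]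
    refine (joinedIn_nrm_segment hQ hQ' hd1).mono ?_
    rintro y ⟨hyN, hyd⟩
    refine ⟨hyN, fun hyS => ?_⟩
    have := hfarQ hη hε y hyS
    linarith [min_le_left (η / 4) (1 / 4)]
  have hJb : JoinedIn (Ncyl \ range (F s)) Qb Qbs := hsegQ hQbN hQbsN hηb_def hε₂ηb hQb_close
  have hJa : JoinedIn (Ncyl \ range (F s)) Qa Qas := hsegQ hQaN hQasN hηa_def hε₂ηa hQa_close
  -- (2) the old paths stay off the new slice
  have hpath : ∀ {p q : EuclideanSpace ℝ (Fin 6)} (γ : Path p q) {d : ℝ},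
      (∀ τ, γ τ ∈ Ncyl \ range (F t)) → ε₂ < d → (∀ z ∈ range γ, d ≤ infDist z (range (F t))) →
      JoinedIn (Ncyl \ range (F s)) p q := by
    intro p q γ d hγ hd hdle
    refine ⟨γ, fun τ => ⟨(hγ τ).1, ?_⟩⟩
    rintro ⟨x, hx⟩
    have h1 : d ≤ infDist (γ τ) (range (F t)) := hdle _ ⟨τ, rfl⟩
    have h2 : infDist (γ τ) (range (F t)) ≤ dist (γ τ) (F t x) := infDist_le_dist_of_mem ⟨x, rfl⟩
    have h3 : ‖F s x - F t x‖ < ε₂ := hclose' x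
    rw [← hx, dist_eq_norm] at h2
    rw [← hx] at h1
    linarith
  have hJγa : JoinedIn (Ncyl \ range (F s)) a Qa := hpath γa hγa hε₂da hdale
  have hJγb : JoinedIn (Ncyl \ range (F s)) b Qb := hpath γb hγb hε₂db hdble
  -- (4) chain: `Qbs ~ Qb ~ b ~ a ~ Qa ~ Qas` in `N ∖ F s (M)`
  have hchain : JoinedIn (Ncyl \ range (F s)) Qbs Qas :=
    (((hJb.symm.trans hJγb.symm).trans hJ.symm).trans hJγa).trans hJa
  -- (5) but the two push-offs of `F s (M)` at `x₀` are on different sides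
  have hns := not_joinedIn_pushoff (h.isSmoothEmbedding s hsT) hιsN (h.contMDiff_normal s hsT) hνsn
    (h.normal_tangent s hsT) hτ₀ (hpo s hsT hs1) x₀
  rcases hŵ with hw | hw
  · apply hns
    rw [hQbs, hQas, hw] at hchain
    exact hchain
  · apply hns
    rw [hQbs, hQas, hw, neg_neg] at hchain
    exact hchain.symm

end OpenHalf

/-- Marker of this part (registered sub-goal `helper_sepPersistsNrmContinuousAt` of stmt-SmoothPoincare4-7632): the radial normalisation is continuous off the axis (`continuousAt_nrm`, moving the reference push-offs with the slice). [folklore] -/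
theorem helper_sepPersistsNrmContinuousAt :
    ∀ u : EuclideanSpace ℝ (Fin 6), Literature.Geometry.Riemannian.SphericalCylinderEntropy.truncL u ≠ 0 → ContinuousAt (fun z : EuclideanSpace ℝ (Fin 6) => (‖Literature.Geometry.Riemannian.SphericalCylinderEntropy.truncL z‖⁻¹ : ℝ) • (z - z (5 : Fin 6) • Literature.Geometry.Manifold.CylinderSlice.axis) + z (5 : Fin 6) • Literature.Geometry.Manifold.CylinderSlice.axis) u :=
  fun _ hu => continuousAt_nrm hu

end Summit.SmoothPoincare4.SmoothPoincare4.Theorems.CylinderEntropySliceIsolation
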